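import Mathlib
import Summits.RiemannHypothesis.RiemannHypothesis.Theorems.WeilFarFloorWindowSmoothing
import Summits.RiemannHypothesis.RiemannHypothesis.Theorems.WeilFarFloorShiftFormLipschitz
import HarnessLib

/-!
# Smooth tests suffice for the far-coercivity floor: a bound for Weil tests on `[−b, b]` bounds `λ_max(a)` for every `a < b`

Helper file (`--supports stmt-RiemannHypothesis-0098`, lead-track anchor: Weil-positivity window ladder, format-C far bound),
pure proofs, RH-free.  Seat rh-explicit-weil-1 gen11 (memo `run/shared/lean/pub/rh-explicit/rh-explicit-weil-1/FORMAT-K3.md` §12.7).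

The floor `λ_max(a) = farCoercivityFloor a` is a supremum over merely measurable bounded window functions, while every explicit-formula
input (`WeilFarFloorRHCeiling`, the Literature `IsWeilTest` world) speaks about SMOOTH compactly supported tests.  The bridge
(`farCoercivityFloor_le_of_weilTest_bound`): **if `Q_b(u) ≤ B·∫u²` for every real Weil test `u` with `tsupport u ⊆ [−b, b]`, then
`λ_max(a) ≤ B` for every `0 < a < b`.**  Proof: Friedrichs smoothing of an admissible `g` by the normalised bump of radius `ε < b − a`
(`WeilFarFloorWindowSmoothing`: a Weil test on `[−(a+ε), a+ε]`, `∫g_ε² ≤ ∫g²`, `∫(g_ε − g)² ≤ δ` once the `L²`-modulus of `g` is `≤ δ` on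
`[−ε, ε]`), the `L²`-continuity of translation on windowed `L²` functions (tree: `SignCone.DualWitness.tendsto_integral_norm_sq_translate_sub`),
and the `L²`-Lipschitz bound for `Q_b` (`WeilFarFloorShiftFormLipschitz`).  Consequently `λ_max(a) ≤ λ_smooth(b) ≤ λ_max(b)` for `a < b`:
up to an arbitrarily small widening of the window, the floor is computed on Weil tests.  Standard axioms only.
-/

set_option linter.dupNamespace false
set_option autoImplicit false

noncomputable section

open MeasureTheory Set Filter
open scoped Real Topology ArithmeticFunction.vonMangoldt

namespace Summit.RiemannHypothesis.RiemannHypothesis.Theorems.WeilFormatC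

namespace FloorSmoothing

open Literature.NumberTheory.LFunctions

/-- `L²`-continuity of translation for an admissible window function, real form: for every `δ > 0` there is `ε > 0` with
`∫ (g(x − y) − g(x))² ≤ δ` for all `|y| ≤ ε` (tree: `tendsto_integral_norm_sq_translate_sub`). -/
theorem exists_modulus_le {b : ℝ} {g : ℝ → ℝ} {C : ℝ} (hg : Measurable g) (hC : ∀ x, |g x| ≤ C)
    (hsupp : ∀ x, x ∉ Icc (-b) b → g x = 0) {δ : ℝ} (hδ : 0 < δ) :
    ∃ ε : ℝ, 0 < ε ∧ ∀ y ∈ Icc (-ε) ε, ∫ x, (g (x - y) - g x) ^ 2 ≤ δ := by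
  obtain ⟨hu, hsu⟩ := memLp_two_ofReal hg hC hsupp
  have ht := SignCone.DualWitness.tendsto_integral_norm_sq_translate_sub hu hsu
  have hev : ∀ᶠ y : ℝ in 𝓝 0, ∫ x, ‖((g (x - y) : ℝ) : ℂ) - (g x : ℂ)‖ ^ 2 < δ :=
    ht.eventually (gt_mem_nhds hδ)
  obtain ⟨ε, hε, hball⟩ := Metric.eventually_nhds_iff.1 hev
  refine ⟨ε / 2, half_pos hε, fun y hy ↦ ?_⟩
  have hyε : dist y 0 < ε := by
    rw [dist_zero_right, Real.norm_eq_abs]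
    exact lt_of_le_of_lt (abs_le.2 ⟨hy.1, hy.2⟩) (by linarith)
  have h1 := hball hyε
  have e : ∫ x, ‖((g (x - y) : ℝ) : ℂ) - (g x : ℂ)‖ ^ 2 = ∫ x, (g (x - y) - g x) ^ 2 :=
    integral_congr_ae (Eventually.of_forall fun x ↦ by
      simp only [← Complex.ofReal_sub, Complex.norm_real, Real.norm_eq_abs, sq_abs])
  rw [e] at h1
  exact h1.le

/-- **Smooth tests suffice**: if `Q_b(u) ≤ B·∫u²` for every real Weil test `u` with `tsupport u ⊆ [−b, b]`, then `λ_max(a) ≤ B`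
for every `0 < a < b`. -/
theorem farCoercivityFloor_le_of_weilTest_bound {a b B : ℝ} (ha : 0 < a) (hab : a < b)
    (hB : ∀ u : ℝ → ℝ, IsWeilTest (fun x ↦ (u x : ℂ)) → tsupport (fun x ↦ (u x : ℂ)) ⊆ Icc (-b) b →
      primeShiftForm b u ≤ B * ∫ x, u x ^ 2) :
    farCoercivityFloor a ≤ B := by
  classical
  refine farCoercivityFloor_le_of_shiftBound ha fun g C hgm hC hsupp ↦ ?_
  set N := ∫ x, g x ^ 2 with hNdef
  have hN : 0 ≤ N := integral_nonneg fun x ↦ sq_nonneg _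
  -- the weight sum of the window `b` and the Lipschitz constant
  set W := ∑ n ∈ weilPrimeIndex b, 2 * ((Λ n : ℝ) / Real.sqrt n) with hWdef
  have hW0 : 0 ≤ W := Finset.sum_nonneg fun n _ ↦
    mul_nonneg (by norm_num) (div_nonneg ArithmeticFunction.vonMangoldt_nonneg (Real.sqrt_nonneg _))
  -- `g` as an admissible function of the window `b`
  have hsuppb : ∀ x, x ∉ Icc (-b) b → g x = 0 := fun x hx ↦ hsupp x fun hm ↦ hx ⟨by linarith [hm.1], by linarith [hm.2]⟩
  have hQab : primeShiftForm a g = primeShiftForm b g := primeShiftForm_eq_of_le hab.le hsupp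
  rw [hQab]
  -- it suffices to beat `B·N + η` for every `η > 0`
  refine le_of_forall_pos_le_add fun η hη ↦ ?_
  -- choose the smoothing radius from the `L²`-modulus of `g`
  set L := (W + |B|) * (2 * Real.sqrt N) + 1 with hLdef
  have hL0 : 0 < L := by positivity
  obtain ⟨ε₀, hε₀, hmod⟩ := exists_modulus_le (b := a) hgm hC hsupp (δ := (η / L) ^ 2) (by positivity)
  set ε := min ε₀ ((b - a) / 2) with hεdef
  have hε0 : 0 < ε := lt_min hε₀ (by linarith)
  have hεε₀ : ε ≤ ε₀ := min_le_left _ _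
  have hεba : a + ε ≤ b := by have := min_le_right ε₀ ((b - a) / 2); rw [← hεdef] at this; linarith
  -- the bump average
  obtain ⟨hψm, hψ0, hψC, hψs, hψ1⟩ := bump_weight hε0
  set ψ : ℝ → ℝ := fun y ↦ (⟨ε / 2, ε, by positivity, by linarith⟩ : ContDiffBump (0 : ℝ)).normed volume y with hψdef
  set gε : ℝ → ℝ := fun x ↦ ∫ y, ψ y * g (x - y) with hgεdef
  obtain ⟨hgεm, hgεb, hgεs⟩ := smoothed_admissible hgm hC hsupp hψm hψ0 hψs hψ1
  have hWT : IsWeilTest fun x ↦ ((gε x : ℝ) : ℂ) := isWeilTest_smoothed hε0 hgm hC hsupp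
  have hTS : tsupport (fun x ↦ ((gε x : ℝ) : ℂ)) ⊆ Icc (-b) b :=
    (tsupport_smoothed_subset hε0 hgm hC hsupp).trans (Icc_subset_Icc (by linarith) hεba)
  have hgεsb : ∀ x, x ∉ Icc (-b) b → gε x = 0 := fun x hx ↦ hgεs x fun hm ↦ hx ⟨by linarith [hm.1], by linarith [hm.2]⟩
  have hgεN : ∫ x, gε x ^ 2 ≤ N := integral_smoothed_sq_le hgm hC hsupp hψm hψ0 hψC hψs hψ1
  have hdist : ∫ x, (gε x - g x) ^ 2 ≤ (η / L) ^ 2 :=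
    integral_sq_smoothed_sub_le hgm hC hsupp hψm hψ0 hψC hψs hψ1 fun y hy ↦
      hmod y ⟨by linarith [hy.1, hεε₀], by linarith [hy.2, hεε₀]⟩
  -- the Weil-test bound for `gε`
  have hB' := hB gε hWT hTS
  -- Lipschitz comparison of `Q_b(g)` and `Q_b(gε)`, and of the norms
  have hsqrt_dist : Real.sqrt (∫ x, (g x - gε x) ^ 2) ≤ η / L := by
    have e : ∫ x, (g x - gε x) ^ 2 = ∫ x, (gε x - g x) ^ 2 :=
      integral_congr_ae (Eventually.of_forall fun x ↦ by simp only; ring)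
    rw [e]
    calc Real.sqrt (∫ x, (gε x - g x) ^ 2) ≤ Real.sqrt ((η / L) ^ 2) := Real.sqrt_le_sqrt hdist
      _ = η / L := Real.sqrt_sq (by positivity)
  have hnormgε : Real.sqrt (∫ x, gε x ^ 2) ≤ Real.sqrt N := Real.sqrt_le_sqrt hgεN
  have hpair : Real.sqrt (∫ x, (g x - gε x) ^ 2) * (Real.sqrt (∫ x, g x ^ 2) + Real.sqrt (∫ x, gε x ^ 2))
      ≤ η / L * (2 * Real.sqrt N) :=
    mul_le_mul hsqrt_dist (by rw [← hNdef]; linarith) (add_nonneg (Real.sqrt_nonneg _) (Real.sqrt_nonneg _))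
      (by positivity)
  have hLip : |primeShiftForm b g - primeShiftForm b gε| ≤ W * (η / L * (2 * Real.sqrt N)) :=
    (abs_primeShiftForm_sub_le (a := b) hgm hgεm hC hgεb hsuppb hgεsb).trans
      (mul_le_mul_of_nonneg_left hpair hW0)
  have hsq : |N - ∫ x, gε x ^ 2| ≤ η / L * (2 * Real.sqrt N) := by
    have h1 := abs_integral_shift_mul_sub_le (a := b) hgm hgεm hC hgεb hsuppb hgεsb 0
    simp only [sub_zero] at h1
    have e1 : ∫ x, g x * g x = N := integral_congr_ae (Eventually.of_forall fun x ↦ by simp only; ring)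
    have e2 : ∫ x, gε x * gε x = ∫ x, gε x ^ 2 := integral_congr_ae (Eventually.of_forall fun x ↦ by simp only; ring)
    rw [e1, e2] at h1
    exact h1.trans hpair
  -- bookkeeping: `(W + |B|)·(η/L)·2√N ≤ η`
  have herr : (W + |B|) * (η / L * (2 * Real.sqrt N)) ≤ η := by
    have e : (W + |B|) * (η / L * (2 * Real.sqrt N)) = η * (((W + |B|) * (2 * Real.sqrt N)) / L) := by
      field_simp
    rw [e]
    have h1 : ((W + |B|) * (2 * Real.sqrt N)) / L ≤ 1 := by
      rw [div_le_one hL0, hLdef]; linarith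
    calc η * (((W + |B|) * (2 * Real.sqrt N)) / L) ≤ η * 1 := mul_le_mul_of_nonneg_left h1 hη.le
      _ = η := mul_one η
  have hdiff := (abs_sub_le_iff.1 hLip).1
  have hBN : B * ∫ x, gε x ^ 2 ≤ B * N + |B| * (η / L * (2 * Real.sqrt N)) := by
    have h1 := abs_sub_le_iff.1 hsq
    rcases le_or_gt 0 B with hB0 | hB0
    · rw [abs_of_nonneg hB0]; nlinarith [h1.1, h1.2, mul_le_mul_of_nonneg_left hgεN hB0]
    · rw [abs_of_neg hB0]; nlinarith [h1.1, h1.2]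
  nlinarith [hB', hdiff, hBN, herr]

/-! ## Appendix (gen11): the converse inequality — Weil tests are admissible, so `λ_smooth(b) ≤ λ_max(b)` -/

/-- **Weil tests are admissible window functions**: for a real Weil test `u` with `tsupport u ⊆ [−b, b]`,
`Q_b(u) ≤ λ_max(b)·∫u²`.  With `farCoercivityFloor_le_of_weilTest_bound`: `λ_max(a) ≤ λ_smooth(b) ≤ λ_max(b)` for `a < b`. -/
theorem primeShiftForm_le_floor_mul_of_weilTest {b : ℝ} {u : ℝ → ℝ} (hu : IsWeilTest (fun x ↦ (u x : ℂ)))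
    (hus : tsupport (fun x ↦ (u x : ℂ)) ⊆ Icc (-b) b) :
    primeShiftForm b u ≤ farCoercivityFloor b * ∫ x, u x ^ 2 := by
  -- `u` is continuous with compact support (as the real part of its complexification), hence measurable and bounded
  have hcont : Continuous u := (Complex.continuous_re.comp hu.1.continuous).congr fun x ↦ by simp
  have hcs : HasCompactSupport u := by
    have h : u = fun x ↦ ((fun x ↦ (u x : ℂ)) x).re := funext fun x ↦ by simp
    rw [h]
    exact hu.2.comp_left Complex.zero_re
  obtain ⟨C, hC⟩ := (hcont.norm).bddAbove_range_of_hasCompactSupport hcs.norm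
  have hCb : ∀ x, |u x| ≤ C := fun x ↦ by
    have := hC ⟨x, rfl⟩; simpa [Real.norm_eq_abs] using this
  have hsupp : ∀ x, x ∉ Icc (-b) b → u x = 0 := by
    intro x hx
    have h : (fun x ↦ (u x : ℂ)) x = 0 := image_eq_zero_of_notMem_tsupport (f := fun x ↦ (u x : ℂ)) fun h ↦ hx (hus h)
    have h' : (u x : ℂ) = 0 := h
    exact_mod_cast h'
  exact primeShiftForm_le_floor_mul hcont.measurable hCb hsupp

end FloorSmoothing

end Summit.RiemannHypothesis.RiemannHypothesis.Theorems.WeilFormatC
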